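import Summits.AtomisticToContinuum.HydrodynamicLimit.Theorems.OneFlightGossipEngineEnergyCurrentTailsFirstPartnerObjects
import Summits.AtomisticToContinuum.HydrodynamicLimit.Theorems.JParityClosureRateFloorMarkedTransfer
import Summits.AtomisticToContinuum.HydrodynamicLimit.Theorems.JParityClosureRateFloorRealisedDatum
import HarnessLib

/-!
# Crux `EnergyCurrentTails` (stmt-AtomisticToContinuum-9235), line `quartic-schur-ledger`, rung-0 certificate of I′:
# S1, the SURE CHARGING `shareRung0_charging` (helper file, `--supports stmt-AtomisticToContinuum-9235`)

Sure kinematics along a hard-sphere trajectory `γ` on `𝕋³` (`IsHardSphereTrajectory`, diameter `ε < 1/2`; the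
registered statement is its instance on the good orbits `t ↦ Φ_t z` of a hard-sphere flow with `ε = ε_N(σ)`,
`0 < σ < 1/2`).  Fix a time `r`, a look-ahead `Δ` and a nonnegative time-independent mark `F₀`.  The first-partner
sum of `y := γ r` (`EnergyCurrentTailsFirstPartner.firstPartnerSum`: marks of the FIRST would-be pairs read at the
free-flight-predicted datum) splits as the realised first-partner sum (`realisedFirstSum`: first pairs none of whose
endpoints takes part in a collision strictly before the predicted contact) plus the DISTURBED part, and the disturbed
part is charged to the collisions of the window `(r, r + Δ]`:

  `ofReal (firstPartnerSum) ≤ ofReal (realisedFirstSum)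
     + Σ_{s ∈ collisionTimes ∩ (r, r + Δ]} Σ_{e ≠ k in contact at s} ofReal (pairSum ε Δ ỹ 0 F₀ {q would-be in ỹ :
         (q.1 = e ∧ q.2 ≠ k) ∨ (q.2 = e ∧ q.1 ≠ k)})`,  `ỹ = collidePair e k (γ s)` the PRE-collisional configuration.

**Proof.**  (1) `firstContact_mem_Ioc_of_mem_wouldBePairs`: the first contact time `t₁` of a would-be pair
`p = (i, j)` of `y` lies in `(0, Δ]`, is attained (distance exactly `ε`), and the free flights are at distance `> ε`
on `(0, t₁)` (`RateFloorMarkedTransfer.first_contact`, `RateFloorWindowPreemption.exists_sep_window`, minimality).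
(2) `exists_first_disturbance`: if `p` is disturbed, some endpoint takes part in a collision during `(r, r + t₁)`;
at the FIRST such time `s` (finitely many candidates, `locFinite`) neither endpoint has collided during `(r, s)`, so
both sit on their free flights on `[r, s)` (`RateFloorPerParticleFreeStretch.stub_perParticleFreeStretch`), their
positions at `s` are the free-flight ones (continuity, `RateFloorWouldBeRealised.apply_fst_eq_freeFlight_of_forall_Ico`)
and so are their left-limit velocities (`RateFloorRealisedDatum.leftLim_apply_snd_eq`).  The collision at `s` is
binary (`IsHardSphereTrajectory.participates_iff`) and is not the contact of `(i, j)` (their distance at `s` is the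
free-flight distance at `s - r ∈ (0, t₁)`, which is `> ε`), so exactly one endpoint `e` collides, with a third
particle `k ∉ {i, j}`, and in the left limit `ỹ = collidePair e k (γ s)` (`leftLim_eq_collidePair`) both `i` and
`j` are on their free flights from `y` after time `s - r`.  (3) `mem_wouldBePairs_of_apply_eq_freeFlight`: free
flights compose (`freeFlight_add`), so `p` is a would-be pair of `ỹ` with first contact time `t₁ - (s - r)` and the
SAME predicted datum, hence the same mark; it passes the filter.  (4) `sum_le_sum_of_charge`: every disturbed pair
`p` is thus one of the summands `(s, e, k, p)` of the fully expanded right-hand side, each summand receives at most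
the pair equal to its own index, and all summands are `≥ 0` (`finsum_mem_eq_finite_toFinset_sum`,
`ENNReal.ofReal_sum_of_nonneg`, `Finset.sum_comm`).

References: Gallagher–Saint-Raymond–Texier 2013 §4.1 (hard-sphere trajectories, collision cylinders);
Cercignani–Illner–Pulvirenti 1994 §4.2; elementary.
-/

noncomputable section

open scoped BigOperators Classical ENNReal InnerProductSpace
open MeasureTheory Set Filter
open Literature.Analysis.FluidPDE Literature.MathematicalPhysics.KineticTheory

namespace Summit.AtomisticToContinuum.HydrodynamicLimit.Theorems

namespace QuarticSchurLedger

open EnergyCurrentTailsFirstPartner RateFloorLine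

variable {n : ℕ} {ε : ℝ} {γ : ℝ → Config n (Fin 3) T3}

/-! ## The first contact time of a would-be pair -/

/-- **First contact of a would-be pair.**  On a hard-sphere trajectory on `𝕋³` with `ε < 1/2`, the first contact
time `t₁ = firstContact ε Δ (γ r) p` of a would-be pair `p` of `γ r` lies in `(0, Δ]`, the free flights of `p` issued
from `γ r` are at distance exactly `ε` at time `t₁`, and at distance `> ε` during `(0, t₁)`
(`RateFloorMarkedTransfer.first_contact`, `RateFloorWindowPreemption.exists_sep_window`, minimality of the infimum).
[folklore] -/
theorem firstContact_mem_Ioc_of_mem_wouldBePairs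
    (hγ : IsHardSphereTrajectory (Torus.geometry (Fin 3)) ε n γ) (hε2 : ε < 2⁻¹) {Δ : ℝ} (r : ℝ)
    {p : Fin n × Fin n} (hp : p ∈ wouldBePairs ε Δ (γ r)) :
    firstContact ε Δ (γ r) p ∈ Set.Ioc 0 Δ ∧
      ‖(Torus.geometry (Fin 3)).sepVec
          (freeFlight (Torus.geometry (Fin 3)) (firstContact ε Δ (γ r) p) (γ r) p.1).1
          (freeFlight (Torus.geometry (Fin 3)) (firstContact ε Δ (γ r) p) (γ r) p.2).1‖ = ε ∧
      ∀ u ∈ Set.Ioo 0 (firstContact ε Δ (γ r) p), ε < ‖(Torus.geometry (Fin 3)).sepVec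
          (freeFlight (Torus.geometry (Fin 3)) u (γ r) p.1).1
          (freeFlight (Torus.geometry (Fin 3)) u (γ r) p.2).1‖ := by
  have hp' := hp
  simp only [wouldBePairs, Finset.mem_filter, Finset.mem_univ, true_and] at hp'
  obtain ⟨hne, hex⟩ := hp'
  obtain ⟨δ, hδ, hsep⟩ := RateFloorWindowPreemption.exists_sep_window hγ hε2 r hne
  have hG := Torus.isHardSphereRegular_geometry (d := Fin 3) hε2
  have hcont : Continuous fun u : ℝ => ‖(Torus.geometry (Fin 3)).sepVec
      (freeFlight (Torus.geometry (Fin 3)) u (γ r) p.1).1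
      (freeFlight (Torus.geometry (Fin 3)) u (γ r) p.2).1‖ := by
    simpa only [Function.comp_def] using
      (hG.continuous_norm_sepVec_config p.1 p.2).comp (hG.continuous_freeFlight (γ r))
  have hfc := RateFloorMarkedTransfer.first_contact hcont hδ hsep hex
    (τ := firstContact ε Δ (γ r) p) rfl
  refine ⟨hfc.1, hfc.2, fun u hu => ?_⟩
  by_contra hle
  have hmem : u ∈ {u : ℝ | u ∈ Set.Ioc 0 Δ ∧ ‖(Torus.geometry (Fin 3)).sepVec
      (freeFlight (Torus.geometry (Fin 3)) u (γ r) p.1).1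
      (freeFlight (Torus.geometry (Fin 3)) u (γ r) p.2).1‖ ≤ ε} :=
    ⟨⟨hu.1, hu.2.le.trans hfc.1.2⟩, not_lt.1 hle⟩
  have hle' : firstContact ε Δ (γ r) p ≤ u := csInf_le ⟨0, fun v hv => hv.1.1.le⟩ hmem
  exact (not_lt.2 hle') hu.2

/-! ## Would-be pairs along the free flight of the pair -/

/-- **Transfer of a would-be pair along its own free flight.**  If in the configuration `w` both members of the
pair `p` (distinct labels) sit on their free flights issued from `y` after a time `τ ∈ (0, t₁)`, `t₁ ≤ Δ` the first
contact time of `p` in `y`, attained, with strict separation before, then `p` is a would-be pair of `w` and its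
first contact time there is `t₁ - τ` (free flights compose, `freeFlight_add`; the infimum is a least element).
[folklore] -/
theorem mem_wouldBePairs_of_apply_eq_freeFlight {Δ τ : ℝ} {y w : Config n (Fin 3) T3}
    {p : Fin n × Fin n} (hne : p.1 ≠ p.2)
    (h1 : w p.1 = freeFlight (Torus.geometry (Fin 3)) τ y p.1)
    (h2 : w p.2 = freeFlight (Torus.geometry (Fin 3)) τ y p.2)
    (hτ : 0 < τ) (hτt : τ < firstContact ε Δ y p) (htΔ : firstContact ε Δ y p ≤ Δ)
    (hcontact : ‖(Torus.geometry (Fin 3)).sepVec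
        (freeFlight (Torus.geometry (Fin 3)) (firstContact ε Δ y p) y p.1).1
        (freeFlight (Torus.geometry (Fin 3)) (firstContact ε Δ y p) y p.2).1‖ ≤ ε)
    (hsep : ∀ u ∈ Set.Ioo 0 (firstContact ε Δ y p), ε < ‖(Torus.geometry (Fin 3)).sepVec
        (freeFlight (Torus.geometry (Fin 3)) u y p.1).1 (freeFlight (Torus.geometry (Fin 3)) u y p.2).1‖) :
    p ∈ wouldBePairs ε Δ w ∧ firstContact ε Δ w p = firstContact ε Δ y p - τ := by
  have hf1 : ∀ u, freeFlight (Torus.geometry (Fin 3)) u w p.1 =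
      freeFlight (Torus.geometry (Fin 3)) (u + τ) y p.1 := fun u => by
    rw [RateFloorPerParticleFreeStretch.freeFlight_apply_congr h1 u, ← freeFlight_add]
  have hf2 : ∀ u, freeFlight (Torus.geometry (Fin 3)) u w p.2 =
      freeFlight (Torus.geometry (Fin 3)) (u + τ) y p.2 := fun u => by
    rw [RateFloorPerParticleFreeStretch.freeFlight_apply_congr h2 u, ← freeFlight_add]
  have hmem : firstContact ε Δ y p - τ ∈ Set.Ioc 0 Δ ∧ ‖(Torus.geometry (Fin 3)).sepVec
      (freeFlight (Torus.geometry (Fin 3)) (firstContact ε Δ y p - τ) w p.1).1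
      (freeFlight (Torus.geometry (Fin 3)) (firstContact ε Δ y p - τ) w p.2).1‖ ≤ ε := by
    refine ⟨⟨by linarith, by linarith⟩, ?_⟩
    rw [hf1, hf2, sub_add_cancel]
    exact hcontact
  refine ⟨?_, ?_⟩
  · simp only [wouldBePairs, Finset.mem_filter, Finset.mem_univ, true_and]
    exact ⟨hne, _, hmem.1, hmem.2⟩
  · show sInf _ = _
    refine IsLeast.csInf_eq ⟨hmem, fun u hu => ?_⟩
    by_contra hlt
    have h := hsep (u + τ) ⟨by linarith [hu.1.1], by linarith [not_le.1 hlt]⟩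
    rw [← hf1, ← hf2] at h
    exact (not_lt.2 hu.2) h

/-! ## The first disturbing collision -/

/-- **The first disturbing collision.**  On a hard-sphere trajectory on `𝕋³` with `ε < 1/2`: if the free flights
of `i`, `j` issued from `γ r` stay at distance `> ε` during `(0, t)`, `t ≤ Δ`, and some endpoint takes part in a
collision during `(r, r + t)`, then at the FIRST such collision time `s ∈ (r, r + t)` an endpoint `e` collides, with a
particle `k ∉ {i, j}`, and in the pre-collisional configuration `collidePair e k (γ s)` (the
left limit of `γ` at `s`) both `i` and `j` sit on their free flights issued from `γ r`: per-particle free stretch on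
`[r, s)`, continuity of positions, left-limit velocities; the collision at `s` is binary and is not the contact of
`(i, j)`, which the separation hypothesis forbids. [folklore] -/
theorem exists_first_disturbance
    (hγ : IsHardSphereTrajectory (Torus.geometry (Fin 3)) ε n γ) (hε2 : ε < 2⁻¹) {r t Δ : ℝ}
    {i j : Fin n} (htΔ : t ≤ Δ)
    (hsep : ∀ u ∈ Set.Ioo 0 t, ε < ‖(Torus.geometry (Fin 3)).sepVec
        (freeFlight (Torus.geometry (Fin 3)) u (γ r) i).1 (freeFlight (Torus.geometry (Fin 3)) u (γ r) j).1‖)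
    (hdist : ∃ u ∈ Set.Ioo r (r + t), Participates (Torus.geometry (Fin 3)) ε (γ u) i ∨
        Participates (Torus.geometry (Fin 3)) ε (γ u) j) :
    ∃ s ∈ collisionTimes (Torus.geometry (Fin 3)) ε γ ∩ Set.Ioc r (r + Δ), ∃ e k : Fin n,
      (e ≠ k ∧ ‖(Torus.geometry (Fin 3)).sepVec (γ s e).1 (γ s k).1‖ = ε) ∧
      ((i = e ∧ j ≠ k) ∨ (j = e ∧ i ≠ k)) ∧
      collidePair (Torus.geometry (Fin 3)) e k (γ s) i =
          freeFlight (Torus.geometry (Fin 3)) (s - r) (γ r) i ∧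
      collidePair (Torus.geometry (Fin 3)) e k (γ s) j =
          freeFlight (Torus.geometry (Fin 3)) (s - r) (γ r) j ∧
      s - r < t := by
  obtain ⟨u₀, hu₀, hP₀⟩ := hdist
  -- the disturbing collision times during `(r, r + t)` are finitely many: `s` is the least one
  have hfin : {u : ℝ | u ∈ Set.Ioo r (r + t) ∧
      (Participates (Torus.geometry (Fin 3)) ε (γ u) i ∨
        Participates (Torus.geometry (Fin 3)) ε (γ u) j)}.Finite :=
    (hγ.locFinite r (r + t)).subset fun u hu =>
      ⟨hu.2.elim (fun h => mem_collisionTimes_iff_exists_participates.2 ⟨_, h⟩)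
        fun h => mem_collisionTimes_iff_exists_participates.2 ⟨_, h⟩, Set.Ioo_subset_Icc_self hu.1⟩
  obtain ⟨s, ⟨hsI, hsP⟩, hsmin⟩ := Set.exists_min_image _ id hfin ⟨u₀, hu₀, hP₀⟩
  have hrs : r < s := hsI.1
  have hquiet : ∀ u ∈ Set.Ioo r s, ¬ Participates (Torus.geometry (Fin 3)) ε (γ u) i ∧
      ¬ Participates (Torus.geometry (Fin 3)) ε (γ u) j := fun u hu => by
    by_contra hcon
    exact (not_le.2 hu.2) (hsmin u ⟨⟨hu.1, hu.2.trans hsI.2⟩,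
      (not_and_or.1 hcon).imp not_not.1 not_not.1⟩)
  -- both endpoints sit on their free flights on `[r, s)`
  have hfree : ∀ m : Fin n, (∀ u ∈ Set.Ioo r s, ¬ Participates (Torus.geometry (Fin 3)) ε (γ u) m) →
      ∀ u ∈ Set.Ico r s, γ u m = freeFlight (Torus.geometry (Fin 3)) (u - r) (γ r) m :=
    fun m hm u hu => RateFloorPerParticleFreeStretch.stub_perParticleFreeStretch n ε γ hγ r u m hu.1
      fun w hw hmem => hm w ⟨hw.1, hw.2.trans_lt hu.2⟩ (mem_collisionTimesOf.1 hmem)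
  have hfi := hfree i fun u hu => (hquiet u hu).1
  have hfj := hfree j fun u hu => (hquiet u hu).2
  have hposi : (γ s i).1 = (freeFlight (Torus.geometry (Fin 3)) (s - r) (γ r) i).1 :=
    RateFloorWouldBeRealised.apply_fst_eq_freeFlight_of_forall_Ico (hγ.pos_continuous i) hrs hfi
  have hposj : (γ s j).1 = (freeFlight (Torus.geometry (Fin 3)) (s - r) (γ r) j).1 :=
    RateFloorWouldBeRealised.apply_fst_eq_freeFlight_of_forall_Ico (hγ.pos_continuous j) hrs hfj
  have hG := Torus.isHardSphereRegular_geometry (d := Fin 3) hε2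
  -- the collision at `s` is not the contact of `(i, j)`
  have hnotij : (i, j) ∉ contactPairs (Torus.geometry (Fin 3)) ε (γ s) := fun hc => by
    have h1 : ‖(Torus.geometry (Fin 3)).sepVec (γ s i).1 (γ s j).1‖ = ε :=
      ((mem_contactPairs_iff_of_mem (hγ.mem s)).1 hc).2
    rw [hposi, hposj] at h1
    exact (hsep (s - r) ⟨by linarith, by linarith [hsI.2]⟩).ne' h1
  have hnotji : (j, i) ∉ contactPairs (Torus.geometry (Fin 3)) ε (γ s) := fun hc =>
    hnotij ((swap_mem_contactPairs_iff hG (p := (i, j))).1 hc)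
  -- the participating endpoint `e` and its partner `k`, as an ordered contact pair
  obtain ⟨e, he, k, hek⟩ : ∃ e, (i = e ∨ j = e) ∧ ∃ k,
      (e, k) ∈ contactPairs (Torus.geometry (Fin 3)) ε (γ s) := by
    rcases hsP with ⟨k, hk | hk⟩ | ⟨k, hk | hk⟩
    · exact ⟨i, Or.inl rfl, k, hk⟩
    · exact ⟨i, Or.inl rfl, k, (swap_mem_contactPairs_iff hG (p := (i, k))).1 hk⟩
    · exact ⟨j, Or.inr rfl, k, hk⟩
    · exact ⟨j, Or.inr rfl, k, (swap_mem_contactPairs_iff hG (p := (j, k))).1 hk⟩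
  have hek_ne : e ≠ k := (mem_contactPairs.1 hek).1
  have hc : γ s ∈ contactSet (Torus.geometry (Fin 3)) n ε e k := (mem_contactPairs.1 hek).2
  have hfilter : (i = e ∧ j ≠ k) ∨ (j = e ∧ i ≠ k) := by
    rcases he with rfl | rfl
    · exact Or.inl ⟨rfl, by rintro rfl; exact hnotij hek⟩
    · exact Or.inr ⟨rfl, by rintro rfl; exact hnotji hek⟩
  -- in the left limit `collidePair e k (γ s)` both endpoints are on their free flights
  have hleft : Function.leftLim γ s = collidePair (Torus.geometry (Fin 3)) e k (γ s) :=
    hγ.leftLim_eq_collidePair hek_ne hc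
  have hstate : ∀ m : Fin n,
      (∀ u ∈ Set.Ico r s, γ u m = freeFlight (Torus.geometry (Fin 3)) (u - r) (γ r) m) →
      collidePair (Torus.geometry (Fin 3)) e k (γ s) m =
        freeFlight (Torus.geometry (Fin 3)) (s - r) (γ r) m := by
    intro m hm
    refine Prod.ext ?_ ?_
    · rw [collidePair_apply_fst]
      exact RateFloorWouldBeRealised.apply_fst_eq_freeFlight_of_forall_Ico (hγ.pos_continuous m) hrs hm
    · rw [← hleft, RateFloorRealisedDatum.leftLim_apply_snd_eq hγ hrs hm, freeFlight_apply]
  exact ⟨s, ⟨mem_collisionTimes_of_mem_contactPairs hek, hsI.1, by linarith [hsI.2]⟩, e, k,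
    ⟨hek_ne, (mem_contactSet.1 hc).2⟩, hfilter, hstate i hfi, hstate j hfj, by linarith [hsI.2]⟩

/-! ## Summation -/

/-- **Charging nonnegative terms to a triple sum.**  If every `p ∈ D` is charged to an index `(s, e, k)`, `s ∈ T`,
at which a condition `c s e k` holds and `p` belongs to a finite set `S s e k`, with `a p = m s e k p`, and `g s e k`
dominates `Σ_{q ∈ S s e k} m s e k q` whenever `c s e k` holds, then `Σ_{p ∈ D} a p ≤ Σ_{s ∈ T} Σₑ Σₖ g s e k` in
`ℝ≥0∞` (each expanded summand `(s, e, k, q)` receives at most the one pair `p = q`; `Finset.sum_comm`). [folklore] -/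
theorem sum_le_sum_of_charge {ι κ α : Type*} [Fintype α] {D : Finset ι} {T : Finset κ}
    {c : κ → α → α → Prop} {S : κ → α → α → Finset ι} {m : κ → α → α → ι → ℝ≥0∞}
    {a : ι → ℝ≥0∞} {g : κ → α → α → ℝ≥0∞}
    (h : ∀ p ∈ D, ∃ s ∈ T, ∃ e k, c s e k ∧ p ∈ S s e k ∧ a p = m s e k p)
    (hg : ∀ s ∈ T, ∀ e k, c s e k → ∑ q ∈ S s e k, m s e k q ≤ g s e k) :
    ∑ p ∈ D, a p ≤ ∑ s ∈ T, ∑ e, ∑ k, g s e k := by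
  classical
  have key : ∀ p ∈ D, a p ≤
      ∑ s ∈ T, ∑ e, ∑ k, if c s e k then (if p ∈ S s e k then m s e k p else 0) else 0 := by
    intro p hp
    obtain ⟨s, hs, e, k, hc, hpS, ha⟩ := h p hp
    calc a p = if c s e k then (if p ∈ S s e k then m s e k p else 0) else 0 := by
          rw [if_pos hc, if_pos hpS, ha]
      _ ≤ ∑ k', if c s e k' then (if p ∈ S s e k' then m s e k' p else 0) else 0 :=
          Finset.single_le_sum_of_canonicallyOrdered
            (f := fun k' => if c s e k' then (if p ∈ S s e k' then m s e k' p else 0) else 0)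
            (Finset.mem_univ k)
      _ ≤ ∑ e', ∑ k', if c s e' k' then (if p ∈ S s e' k' then m s e' k' p else 0) else 0 :=
          Finset.single_le_sum_of_canonicallyOrdered
            (f := fun e' => ∑ k', if c s e' k' then (if p ∈ S s e' k' then m s e' k' p else 0) else 0)
            (Finset.mem_univ e)
      _ ≤ _ :=
          Finset.single_le_sum_of_canonicallyOrdered
            (f := fun s' => ∑ e', ∑ k',
              if c s' e' k' then (if p ∈ S s' e' k' then m s' e' k' p else 0) else 0) hs
  calc ∑ p ∈ D, a p
      ≤ ∑ p ∈ D, ∑ s ∈ T, ∑ e, ∑ k, if c s e k then (if p ∈ S s e k then m s e k p else 0) else 0 :=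
        Finset.sum_le_sum key
    _ = ∑ s ∈ T, ∑ e, ∑ k, ∑ p ∈ D, if c s e k then (if p ∈ S s e k then m s e k p else 0) else 0 := by
        rw [Finset.sum_comm]
        refine Finset.sum_congr rfl fun s _ => ?_
        rw [Finset.sum_comm]
        exact Finset.sum_congr rfl fun e _ => Finset.sum_comm
    _ ≤ ∑ s ∈ T, ∑ e, ∑ k, g s e k := by
        refine Finset.sum_le_sum fun s hs => Finset.sum_le_sum fun e _ =>
          Finset.sum_le_sum fun k _ => ?_
        by_cases hc : c s e k
        · calc ∑ p ∈ D, (if c s e k then (if p ∈ S s e k then m s e k p else 0) else 0)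
              = ∑ p ∈ D, if p ∈ S s e k then m s e k p else 0 :=
                Finset.sum_congr rfl fun p _ => if_pos hc
            _ = ∑ p ∈ D.filter (· ∈ S s e k), m s e k p := (Finset.sum_filter _ _).symm
            _ ≤ ∑ q ∈ S s e k, m s e k q :=
                Finset.sum_le_sum_of_subset fun q hq => (Finset.mem_filter.1 hq).2
            _ ≤ g s e k := hg s hs e k hc
        · exact (Finset.sum_eq_zero fun p _ => if_neg hc).trans_le zero_le

/-- Marked pair sums of a nonnegative mark are nonnegative. [folklore] -/
theorem pairSum_nonneg {Δ : ℝ} (z : Config n (Fin 3) T3) (s : ℝ) {F : ℝ → T3 → T3 → V3 → V3 → ℝ}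
    (hF : ∀ u x y v w, 0 ≤ F u x y v w) (S : Finset (Fin n × Fin n)) : 0 ≤ pairSum ε Δ z s F S :=
  Finset.sum_nonneg fun _ _ => hF _ _ _ _ _

/-! ## The charging along a hard-sphere trajectory -/

/-- **Sure charging of the disturbed first-partner marks** along a hard-sphere trajectory on `𝕋³` with
`ε < 1/2` (the content of `shareRung0_charging`): the first-partner sum of `γ r` is at most the realised
first-partner sum plus the collision sum, over the collisions `(s, e, k)` of `(r, r + Δ]`, of the forward-cone charge
of the pre-collisional configuration `collidePair e k (γ s)`.  Proof in the module docstring. [folklore] -/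
theorem ofReal_firstPartnerSum_le_add_collisionSum
    (hγ : IsHardSphereTrajectory (Torus.geometry (Fin 3)) ε n γ) (hε2 : ε < 2⁻¹)
    (F₀ : T3 → T3 → V3 → V3 → ℝ) (hF₀ : ∀ x y v w, 0 ≤ F₀ x y v w) (r Δ : ℝ) :
    ENNReal.ofReal (firstPartnerSum ε Δ (γ r) r (fun _ => F₀)) ≤
      ENNReal.ofReal (realisedFirstSum ε Δ γ r (fun _ => F₀)) +
        ∑ᶠ s ∈ collisionTimes (Torus.geometry (Fin 3)) ε γ ∩ Set.Ioc r (r + Δ), ∑ e : Fin n, ∑ k : Fin n,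
          (if e ≠ k ∧ ‖(Torus.geometry (Fin 3)).sepVec (γ s e).1 (γ s k).1‖ = ε then
            ENNReal.ofReal (pairSum ε Δ (collidePair (Torus.geometry (Fin 3)) e k (γ s)) 0 (fun _ => F₀)
              ((wouldBePairs ε Δ (collidePair (Torus.geometry (Fin 3)) e k (γ s))).filter fun p =>
                (p.1 = e ∧ p.2 ≠ k) ∨ (p.2 = e ∧ p.1 ≠ k)))
          else 0) := by
  classical
  have hfin : (collisionTimes (Torus.geometry (Fin 3)) ε γ ∩ Set.Ioc r (r + Δ)).Finite :=
    hγ.finite_collisionTimes_inter_of_subset_Icc Set.Ioc_subset_Icc_self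
  rw [finsum_mem_eq_finite_toFinset_sum _ hfin]
  -- (1) the first-partner sum splits into the realised part and the disturbed part
  have hsplit : firstPartnerSum ε Δ (γ r) r (fun _ => F₀) = realisedFirstSum ε Δ γ r (fun _ => F₀) +
      ∑ p ∈ firstPairs ε Δ (γ r) \ (firstPairs ε Δ (γ r) ∩ realisedPairs ε Δ γ r),
        F₀ (freeFlight (Torus.geometry (Fin 3)) (firstContact ε Δ (γ r) p) (γ r) p.1).1
          (freeFlight (Torus.geometry (Fin 3)) (firstContact ε Δ (γ r) p) (γ r) p.2).1
          (γ r p.1).2 (γ r p.2).2 := by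
    simp only [firstPartnerSum, realisedFirstSum, pairSum]
    rw [← Finset.sum_sdiff (inter_realisedPairs_subset_firstPairs ε Δ γ r), add_comm]
  have h1 : 0 ≤ realisedFirstSum ε Δ γ r (fun _ => F₀) := pairSum_nonneg _ _ (fun _ => hF₀) _
  have h2 : ∀ p ∈ firstPairs ε Δ (γ r) \ (firstPairs ε Δ (γ r) ∩ realisedPairs ε Δ γ r),
      0 ≤ F₀ (freeFlight (Torus.geometry (Fin 3)) (firstContact ε Δ (γ r) p) (γ r) p.1).1
        (freeFlight (Torus.geometry (Fin 3)) (firstContact ε Δ (γ r) p) (γ r) p.2).1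
        (γ r p.1).2 (γ r p.2).2 := fun _ _ => hF₀ _ _ _ _
  rw [hsplit, ENNReal.ofReal_add h1 (Finset.sum_nonneg h2), ENNReal.ofReal_sum_of_nonneg h2]
  -- (2)-(3) every disturbed first pair is charged to its first disturbing collision, with the same mark
  have key : ∀ p ∈ firstPairs ε Δ (γ r) \ (firstPairs ε Δ (γ r) ∩ realisedPairs ε Δ γ r),
      ∃ s ∈ hfin.toFinset, ∃ e k : Fin n,
        (e ≠ k ∧ ‖(Torus.geometry (Fin 3)).sepVec (γ s e).1 (γ s k).1‖ = ε) ∧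
        p ∈ (wouldBePairs ε Δ (collidePair (Torus.geometry (Fin 3)) e k (γ s))).filter
            (fun p => (p.1 = e ∧ p.2 ≠ k) ∨ (p.2 = e ∧ p.1 ≠ k)) ∧
        ENNReal.ofReal (F₀
            (freeFlight (Torus.geometry (Fin 3)) (firstContact ε Δ (γ r) p) (γ r) p.1).1
            (freeFlight (Torus.geometry (Fin 3)) (firstContact ε Δ (γ r) p) (γ r) p.2).1
            (γ r p.1).2 (γ r p.2).2) =
          ENNReal.ofReal (F₀
            (freeFlight (Torus.geometry (Fin 3))
              (firstContact ε Δ (collidePair (Torus.geometry (Fin 3)) e k (γ s)) p)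
              (collidePair (Torus.geometry (Fin 3)) e k (γ s)) p.1).1
            (freeFlight (Torus.geometry (Fin 3))
              (firstContact ε Δ (collidePair (Torus.geometry (Fin 3)) e k (γ s)) p)
              (collidePair (Torus.geometry (Fin 3)) e k (γ s)) p.2).1
            (collidePair (Torus.geometry (Fin 3)) e k (γ s) p.1).2
            (collidePair (Torus.geometry (Fin 3)) e k (γ s) p.2).2) := by
    intro p hp
    obtain ⟨hpF, hpR⟩ := Finset.mem_sdiff.1 hp
    have hpW : p ∈ wouldBePairs ε Δ (γ r) := firstPairs_subset_wouldBePairs ε Δ (γ r) hpF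
    have hpW' := hpW
    simp only [wouldBePairs, Finset.mem_filter, Finset.mem_univ, true_and] at hpW'
    obtain ⟨hne, hex⟩ := hpW'
    obtain ⟨htI, hcontact, hsep⟩ := firstContact_mem_Ioc_of_mem_wouldBePairs hγ hε2 r hpW
    -- `p` is disturbed: some endpoint takes part in a collision before the predicted contact
    have hdist : ∃ u ∈ Set.Ioo r (r + firstContact ε Δ (γ r) p),
        Participates (Torus.geometry (Fin 3)) ε (γ u) p.1 ∨
          Participates (Torus.geometry (Fin 3)) ε (γ u) p.2 := by
      by_contra hcon
      push Not at hcon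
      refine hpR (Finset.mem_inter.2 ⟨hpF, ?_⟩)
      simp only [realisedPairs, Finset.mem_filter, Finset.mem_univ, true_and]
      exact ⟨hne, hex, fun u hu => (hcon u hu).1, fun u hu => (hcon u hu).2⟩
    obtain ⟨s, hsT, e, k, hck, hfilter, h1, h2, hst⟩ :=
      exists_first_disturbance hγ hε2 htI.2 hsep hdist
    obtain ⟨hpW'', hfc⟩ := mem_wouldBePairs_of_apply_eq_freeFlight hne h1 h2
      (by linarith [hsT.2.1]) hst htI.2 hcontact.le hsep
    refine ⟨s, hfin.mem_toFinset.2 hsT, e, k, hck, Finset.mem_filter.2 ⟨hpW'', hfilter⟩, ?_⟩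
    -- the predicted data, hence the marks, agree
    have hflight : ∀ m : Fin n, collidePair (Torus.geometry (Fin 3)) e k (γ s) m =
        freeFlight (Torus.geometry (Fin 3)) (s - r) (γ r) m →
        freeFlight (Torus.geometry (Fin 3))
            (firstContact ε Δ (collidePair (Torus.geometry (Fin 3)) e k (γ s)) p)
            (collidePair (Torus.geometry (Fin 3)) e k (γ s)) m =
          freeFlight (Torus.geometry (Fin 3)) (firstContact ε Δ (γ r) p) (γ r) m := fun m hm => by
      rw [RateFloorPerParticleFreeStretch.freeFlight_apply_congr hm, ← freeFlight_add, hfc, sub_add_cancel]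
    have hvel : ∀ m : Fin n, collidePair (Torus.geometry (Fin 3)) e k (γ s) m =
        freeFlight (Torus.geometry (Fin 3)) (s - r) (γ r) m →
        (collidePair (Torus.geometry (Fin 3)) e k (γ s) m).2 = (γ r m).2 := fun m hm => by
      rw [hm, freeFlight_apply]
    rw [hflight p.1 h1, hflight p.2 h2, hvel p.1 h1, hvel p.2 h2]
  -- (4) summation
  refine add_le_add le_rfl (sum_le_sum_of_charge key fun s _ e k hc => ?_)
  rw [if_pos hc]
  exact (ENNReal.ofReal_sum_of_nonneg fun _ _ => hF₀ _ _ _ _).ge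

/-- **S1 · sure charging of the disturbed first-partner marks to the first disturbing collision.** -/
theorem shareRung0_charging : ∀ (σ : ℝ), 0 < σ → σ < 1 / 2 → ∀ (N : ℕ) (Φ : HardSphereFlow (Torus.geometry (Fin 3)) (hsDiameter σ N) (N + 1)) (z : Config (N + 1) (Fin 3) T3), z ∈ Φ.good → ∀ (F₀ : T3 → T3 → V3 → V3 → ℝ), (∀ x y v w, 0 ≤ F₀ x y v w) → ∀ (r Δ : ℝ), 0 < Δ → ENNReal.ofReal (firstPartnerSum (hsDiameter σ N) Δ (Φ.flow r z) r (fun _ => F₀)) ≤ ENNReal.ofReal (realisedFirstSum (hsDiameter σ N) Δ (fun t => Φ.flow t z) r (fun _ => F₀)) + ∑ᶠ s ∈ collisionTimes (Torus.geometry (Fin 3)) (hsDiameter σ N) (fun t => Φ.flow t z) ∩ Set.Ioc r (r + Δ), ∑ e : Fin (N + 1), ∑ k : Fin (N + 1), (if e ≠ k ∧ ‖(Torus.geometry (Fin 3)).sepVec (Φ.flow s z e).1 (Φ.flow s z k).1‖ = hsDiameter σ N then ENNReal.ofReal (pairSum (hsDiameter σ N) Δ (collidePair (Torus.geometry (Fin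 3)) e k (Φ.flow s z)) 0 (fun _ => F₀) ((wouldBePairs (hsDiameter σ N) Δ (collidePair (Torus.geometry (Fin 3)) e k (Φ.flow s z))).filter fun p => (p.1 = e ∧ p.2 ≠ k) ∨ (p.2 = e ∧ p.1 ≠ k))) else 0) := by
  intro σ hσ hσ2 N Φ z hz F₀ hF₀ r Δ _hΔ
  exact ofReal_firstPartnerSum_le_add_collisionSum (Φ.isTrajectory z hz)
    ((hsDiameter_le hσ.le N).trans_lt (hσ2.trans_eq (one_div 2))) F₀ hF₀ r Δ

end QuarticSchurLedger

end Summit.AtomisticToContinuum.HydrodynamicLimit.Theorems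

end
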